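import Summits.Schanuel.Schanuel.Theorems.RootDecomp1KDegreeLadder03

/-!
# RootDecomp1KDegreeLadder — lens 1, generation 45 «DEGREE LADDER AT FIXED SKEL-QUALITY (DL) + THIN-FIBRE RESIDUAL» (lane K-R30 (b); CLAIM L2155, ACK/CHECKLIST K-g45 L2159, NODE L2213 / REQUEST L2214, writer re-checks L2219/L2221/L2230, critic VERDICT L2216: CLEARED — THEOREM ×1 for DL `degreeLadder`; EDITION 2/3 docstring-only accepted L2224 / files of record L2228 (K ed. 3 f2af863f…); RULE K-R31; lens-1 tally credits ×11 + THEOREM ×2) — continuation (RootDecomp1KDegreeLadder04): §4 engine B + §5 the degree ladder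

(lens-1 g45 HOME kernel K = HOME/decomp-schanuel-lens-1/g45/DegreeLadder.lean EDITION 3 f2af863f…, 2183 l, imports tree `…RootDecomp1KSkelCell01` (the tree now has `…SkelCell10` with §8's `SkelLiouvilleFix`); P DLprobe.lean f44a49e4… rc 0, C DLctrl.lean 394594cd… rc 1 = exactly the 13 planted errors. Port by census-1 gen 19 as `RootDecomp1KDegreeLadder01`–`08` (+ `09` deferred): 01 = K's module doc + §0 residue (`skelLiouvilleFix_of_skelLiouville`, `SkelLiouvilleFix.liouville` / `.transcendental` declared in the TREE namespace `…RootDecomp1KSkelCell` so dot-notation keeps working) + §1 toolkit `bev`/`xdeg`/`dX`/`specX`; 02 = §2 truncations + §3 calculus (`tangent`, Lipschitz, `coeff_specX_bound`); 03 = §4 engine A (`onCurve_exponent_ineq`, `engine_core`); 04 = §4 engine B (`lowDegree_clause`, `engine_of_clause`, `engine`) + §5 THE DEGREE LADDER `degreeLadder (d) (ρ) (hρ : SkelLiouvilleFix (d + 1) ρ) (P : ℤ[X][X]) (hP : P ≠ 0) (hdeg : P.natDegree ≤ d) : bev P (liouvilleNumber 2) ρ ≠ 0` (descent `no_relation_of_engine`);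 05 = §5b limit corollary (`algebraicIndependent_of_forall_fix`) + §5c relative degree (`relDegree_gt`, `skelFix_two_not_mem_adjoin(_complex)`); 06 = §5d the residual `ThinFibre`/`ThinFibreAt` (+ glue `thinFibre_imp_b`) + §6 the toy fibre decided (`sq_fibre_iff`, `toy_clause`); 07 = §7 tightness at d = 1 (`degreeLadder_tight_one`, `rU_injective`, `not_thinFibre_one`, `not_thinFibre_zero`); 08 = §8a the 2-adic mechanism (`two_adic_split`, `two_adic_quality`, hypothesis-free); 09 (DEFERRED until Literature `…DiophantineApproximation.RidoutIntegers` builds on the check farm, rc 75 today) = §8b `isSquare_mul_psNumer_finite`, `isSquare_seventeen_mul_psNumer_finite`, `thinFibreAt_sqMulP` with `Ridout.padicRoth_int` BY NAME (K carries them under a `(hR : PadicRothInt)` binder whose `def` is NOT landed — verdict condition (c)).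
PORT EDITS: import `…SkelCell10` instead of `…SkelCell01` and DELETE K's verbatim copies of the tree's §8 (`SkelLiouvilleFix`, `skelLiouville_iff_fix`, `SkelLiouvilleFix.mono`, `uStar`, `dU`, `rU`, `dU_cast`, `two_pow_le_four_mul_dU`, `two_mul_dU_lt`, `one_le_dU`, `rU_den`, `rU_cast`, `uStar_sub_rU`, `skelLiouvilleFix_one_uStar`, `not_skelFixOne_algebraicIndependent` — 15 blocks, opened from `…RootDecomp1KSkelCell` by name; verdict condition (a)); the file-wide linter option dropped (b); 58 one-line docstrings added to undocumented helper lemmas; 34 small generic ℓ₂/`psNumer`/`partialSum`/cast lemmas made PRIVATE (dedup-safety against tree twins in TwoBaseCell/CommonRadixCell/SkelCell/RadixCell) with per-part private copies; `ThinFibre`/`ThinFibreAt` docstrings carry the residual-class tag (d); graded statements and proofs otherwise verbatim. `--supports stmt-Schanuel-33364`; no census credit carried; rung 0 — nothing here proves Schanuel, `FiniteOrderLiouvilleSchanuel` (33364), `CoordLiouvilleSchanuel` (31077) or (b) at fixed quality.)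
-/

noncomputable section

open Polynomial LiouvilleNumber
open scoped Nat

namespace Summit.Schanuel.Schanuel.Theorems.RootDecomp1KDegreeLadder

open Summit.Schanuel.Schanuel.Theorems.RootDecomp1KSkelCell
  (exists_le_two_pow_factorial iota iota_spec iota_le_of_le pow_lt_of_lt_iota lt_iota_of_pow_lt iota_mono
   one_le_iota SkelLiouville SkelLiouvilleFix skelLiouville_iff_fix SkelLiouvilleFix.mono uStar dU rU dU_cast
   two_pow_le_four_mul_dU two_mul_dU_lt one_le_dU rU_den rU_cast uStar_sub_rU skelLiouvilleFix_one_uStar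
   not_skelFixOne_algebraicIndependent)
open Summit.Schanuel.Schanuel.Theorems.RootDecomp1KTwoBaseCell (psNumer partialSum_eq_psNumer_div coprime_psNumer
  algebraicIndependent_of_forall_int')
open Summit.Schanuel.Schanuel.Theorems.RootDecomp1KRelLiouvilleCell (partialSum_two_strictMono
  partialSum_two_lt_liouvilleNumber abs_liouvilleNumber_two_sub_partialSum)

section Engine

/-- `s_N = p_N / 2^{N!}` (tree `partialSum_eq_psNumer_div` at `b = 2`). -/
private theorem partialSum_two (N : ℕ) : partialSum 2 N = (psNumer 2 N : ℝ) / (2 : ℝ) ^ N ! := by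
  have := partialSum_eq_psNumer_div (b := 2) (by norm_num) N
  simpa using this

/-- `ℓ₂ = liouvilleNumber 2` is Liouville (Mathlib). -/
private theorem liouville_ell2 : Liouville (liouvilleNumber 2) := by
  have h := liouville_liouvilleNumber (le_refl 2)
  simpa using h

/-- Non-degeneracy transfer: if the cleared specialisation `specX P r = q^d·P(·, r) ∈ ℤ[x]` is non-zero then
`P(x, r) ≠ 0` for some real `x` (and conversely, `aeval_specX`). -/
theorem exists_bev_ne_zero_of_specX_ne_zero {P : ℤ[X][X]} {r : ℚ} (h : specX P r ≠ 0) :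
    ∃ x : ℝ, bev P x r ≠ 0 := by
  by_contra hx
  have hx' : ∀ x : ℝ, bev P x r = 0 := fun x => by
    by_contra h'
    exact hx ⟨x, h'⟩
  apply h
  have hmap : (specX P r).map (Int.castRingHom ℝ) = 0 := by
    refine Polynomial.funext fun x => ?_
    have h1 := aeval_specX P r x
    rw [hx' x, mul_zero, Polynomial.aeval_def, algebraMap_int_eq] at h1
    rw [Polynomial.eval_map, Polynomial.eval_zero]
    exact h1
  exact (Polynomial.map_eq_zero_iff (Int.castRingHom ℝ).injective_int).mp hmap

/-- If `P(x, r) ≠ 0` then the specialisation `specX P r` is non-zero. -/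
theorem specX_ne_zero_of_bev_ne_zero {P : ℤ[X][X]} {r : ℚ} {x : ℝ} (h : bev P x r ≠ 0) :
    specX P r ≠ 0 := by
  intro h0
  apply h
  have h1 := aeval_specX P r x
  rw [h0, map_zero] at h1
  have hqd : (r.den : ℝ) ^ P.natDegree ≠ 0 := pow_ne_zero _ (by exact_mod_cast r.den_pos.ne')
  rcases mul_eq_zero.mp h1.symm with h2 | h2
  · exact absurd h2 hqd
  · exact h2

/-- **THE GAUSS HALF — the thin-fibre clause in LOW `Y`-degree (PROVED, hypothesis-free).**  For `P` of
`Y`-degree `d < m₀` and any `C`: beyond some level `N₀`, every NON-DEGENERATE rational point `r` (`P(·, r) ≢ 0`)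
with `|r| ≤ C` ON the level curve `P(s_N, ·) = 0` (`s_N = psNumer 2 N / 2^{N!}`) has a LARGE denominator,
`den(r)^{m₀·N} > C·2^{(N+1)!}`.  Gauss: `s_N` in lowest terms is a root of `specX P r ∈ ℤ[x]`, so
`2^{N!} ≤ |lc| ≤ C₃ den(r)^d` (`le_abs_leadingCoeff_of_root`, `coeff_specX_bound_abs`); against
`den(r)^{(d+1)N} ≤ den(r)^{m₀ N} ≤ C·2^{(N+1)!}` this is `onCurve_exponent_ineq`.  This is literally the clause of
`ThinFibre m₀` (§5d) for the curves of `Y`-degree `< m₀`: the exchange rate `m = d + 1` of the ladder. -/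
theorem lowDegree_clause {P : ℤ[X][X]} {m₀ : ℕ} (hdm : P.natDegree < m₀) (C : ℝ) :
    ∃ N₀ : ℕ, ∀ N : ℕ, N₀ ≤ N → ∀ r : ℚ, |(r : ℝ)| ≤ C → bev P (partialSum 2 N) r = 0 →
      (∃ x : ℝ, bev P x r ≠ 0) → C * 2 ^ (N + 1)! < (r.den : ℝ) ^ (m₀ * N) := by
  classical
  set d : ℕ := P.natDegree with hd'
  obtain ⟨C₃, hC₃0, hC₃⟩ := coeff_specX_bound_abs P (max C 1) (le_max_right _ _)
  set B : ℝ := max C 1 + 1 with hB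
  have hB0 : 0 < B := by have := le_max_right C 1; rw [hB]; linarith
  set L : ℕ := ⌈B + C₃⌉₊ + 2 with hL
  have hCL : B + C₃ ≤ (2 : ℝ) ^ L := by
    have h1 : B + C₃ ≤ ⌈B + C₃⌉₊ := Nat.le_ceil _
    have h2 : ((⌈B + C₃⌉₊ + 2 : ℕ) : ℝ) ≤ (2 : ℝ) ^ (⌈B + C₃⌉₊ + 2) := by
      exact_mod_cast (Nat.lt_two_pow_self).le
    push_cast at h2; linarith
  have hBB : B ≤ (2 : ℝ) ^ L := by linarith
  have hBC₃ : C₃ ≤ (2 : ℝ) ^ L := by linarith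
  refine ⟨L * (2 * d + 1) + d + 2, fun N hN r hrC hA hx => ?_⟩
  obtain ⟨x, hx⟩ := hx
  have hspec0 : specX P r ≠ 0 := specX_ne_zero_of_bev_ne_zero hx
  set q : ℕ := r.den with hq
  have hqRpos : (0 : ℝ) < q := by exact_mod_cast r.den_pos
  have hqR1 : (1 : ℝ) ≤ q := by exact_mod_cast r.den_pos
  have hN2' : 2 ≤ N := by omega
  have hNd : L * (2 * d + 1) + d + 1 ≤ N := by omega
  set W : ℝ := (2 : ℝ) ^ (N + 1)! with hW
  have hWpos : 0 < W := by positivity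
  -- Gauss: `2^{N!} ≤ |lc (specX P r)| ≤ C₃ q^d`
  have hsNfrac : partialSum 2 N = (((psNumer 2 N : ℕ) : ℤ) : ℝ) / ((2 ^ N ! : ℕ) : ℝ) := by
    rw [partialSum_two]; push_cast; rfl
  have hcop : IsCoprime (((2 ^ N ! : ℕ) : ℤ)) (((psNumer 2 N : ℕ) : ℤ)) :=
    Nat.isCoprime_iff_coprime.mpr (coprime_psNumer_two_pow hN2' (N !))
  have hrootN : aeval ((((psNumer 2 N : ℕ) : ℤ) : ℝ) / ((2 ^ N ! : ℕ) : ℝ)) (specX P r) = 0 := by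
    rw [← hsNfrac, aeval_specX, hA, mul_zero]
  have hG := le_abs_leadingCoeff_of_root (specX P r) hspec0 (by positivity) hcop hrootN
  have hV : (2 : ℝ) ^ N ! ≤ C₃ * (q : ℝ) ^ d := by
    have h1 : (((2 ^ N ! : ℕ) : ℤ) : ℝ) ≤ ((|(specX P r).leadingCoeff| : ℤ) : ℝ) := by
      exact_mod_cast hG
    push_cast at h1
    exact h1.trans (hC₃ r (hrC.trans (le_max_left _ _)) _)
  by_contra hsmall
  rw [not_lt] at hsmall
  rcases Nat.eq_zero_or_pos d with hd0 | hdpos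
  · -- `Y`-degree 0: Gauss alone bounds the level
    rw [hd0, pow_zero, mul_one] at hV
    have h1 : (2 : ℝ) ^ N ! ≤ (2 : ℝ) ^ L := hV.trans hBC₃
    rw [pow_le_pow_iff_right₀ (by norm_num : (1 : ℝ) < 2)] at h1
    have h2 : N ≤ N ! := Nat.self_le_factorial N
    have hLN : L + 2 ≤ N := by rw [hd0] at hN; simpa using hN
    omega
  -- `Y`-degree `d ≥ 1`: smallness, weakened to the exponent `(d+1)·N` and made strict with `B = max C 1 + 1`
  set Q : ℝ := (q : ℝ) ^ ((d + 1) * N) with hQ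
  have hstar : Q < B * W := by
    calc Q ≤ (q : ℝ) ^ (m₀ * N) := pow_le_pow_right₀ hqR1 (Nat.mul_le_mul_right _ (by omega))
      _ ≤ C * W := hsmall
      _ ≤ max C 1 * W := mul_le_mul_of_nonneg_right (le_max_left _ _) hWpos.le
      _ < B * W := by rw [hB]; nlinarith
  set V : ℝ := (2 : ℝ) ^ N ! with hVdef
  have hVpos : 0 < V := by positivity
  have h1 : V ^ ((d + 1) * N) ≤ C₃ ^ ((d + 1) * N) * Q ^ d := by
    calc V ^ ((d + 1) * N) ≤ (C₃ * (q : ℝ) ^ d) ^ ((d + 1) * N) := pow_le_pow_left₀ hVpos.le hV _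
      _ = C₃ ^ ((d + 1) * N) * Q ^ d := by
          rw [mul_pow, hQ, ← pow_mul, ← pow_mul, mul_comm d]
  have h2 : Q ^ d < (B * W) ^ d := pow_lt_pow_left₀ hstar (by positivity) (by omega)
  have h3 : C₃ ^ ((d + 1) * N) ≤ ((2 : ℝ) ^ L) ^ ((d + 1) * N) := pow_le_pow_left₀ hC₃0.le hBC₃ _
  have h4 : (B * W) ^ d ≤ ((2 : ℝ) ^ L * W) ^ d :=
    pow_le_pow_left₀ (by positivity) (mul_le_mul_of_nonneg_right hBB hWpos.le) _
  have h5 : V ^ ((d + 1) * N) < ((2 : ℝ) ^ L) ^ ((d + 1) * N) * ((2 : ℝ) ^ L) ^ d * W ^ d := by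
    calc V ^ ((d + 1) * N) ≤ C₃ ^ ((d + 1) * N) * Q ^ d := h1
      _ < C₃ ^ ((d + 1) * N) * (B * W) ^ d := mul_lt_mul_of_pos_left h2 (by positivity)
      _ ≤ ((2 : ℝ) ^ L) ^ ((d + 1) * N) * ((2 : ℝ) ^ L * W) ^ d :=
          mul_le_mul h3 h4 (by positivity) (by positivity)
      _ = ((2 : ℝ) ^ L) ^ ((d + 1) * N) * ((2 : ℝ) ^ L) ^ d * W ^ d := by rw [mul_pow]; ring
  rw [hVdef, hW, ← pow_mul, ← pow_mul, ← pow_mul, ← pow_mul, ← pow_add, ← pow_add,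
    pow_lt_pow_iff_right₀ (by norm_num : (1 : ℝ) < 2)] at h5
  have h7 := onCurve_exponent_ineq hNd
  omega

/-- **ENGINE ⇐ CLAUSE.**  `engine_core` + the thin-fibre clause at quality `m` for THIS `P` (all `C`) is
contradictory: the core supplies, beyond every threshold, a non-degenerate on-curve point `r` within `1` of `ρ`
above a level `N` with `den(r)^{m N} < C·2^{(N+1)!}`; the clause (window `max C (|ρ|+1)`) forbids it. -/
theorem engine_of_clause {P : ℤ[X][X]} {ρ : ℝ} {m : ℕ} (hm : 1 ≤ m) (hd : 1 ≤ P.natDegree)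
    (hroot : bev P (liouvilleNumber 2) ρ = 0) (hτ : bev (dX P) (liouvilleNumber 2) ρ ≠ 0)
    (hρ : SkelLiouvilleFix m ρ)
    (hcl : ∀ C : ℝ, ∃ N₀ : ℕ, ∀ N : ℕ, N₀ ≤ N → ∀ r : ℚ, |(r : ℝ)| ≤ C →
      bev P (partialSum 2 N) r = 0 → (∃ x : ℝ, bev P x r ≠ 0) →
        C * 2 ^ (N + 1)! < (r.den : ℝ) ^ (m * N)) : False := by
  obtain ⟨C, hC0, hcore⟩ := engine_core hm hd hroot hτ hρ
  obtain ⟨N₀, hN₀⟩ := hcl (max C (|ρ| + 1))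
  obtain ⟨r, N, -, hN, hr1, hA, hspec, hstar⟩ := hcore N₀
  have hrabs : |(r : ℝ)| ≤ max C (|ρ| + 1) := by
    have := abs_sub_abs_le_abs_sub (r : ℝ) ρ
    exact le_max_of_le_right (by linarith)
  have h := hN₀ N hN r hrabs hA (exists_bev_ne_zero_of_specX_ne_zero hspec)
  have hW : (0 : ℝ) < 2 ^ (N + 1)! := by positivity
  have : C * 2 ^ (N + 1)! ≤ max C (|ρ| + 1) * 2 ^ (N + 1)! :=
    mul_le_mul_of_nonneg_right (le_max_left _ _) hW.le
  linarith

/-- **THE ENGINE at the exchange rate `m = d + 1`** = `engine_of_clause` fed with the PROVED low-degree clause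
`lowDegree_clause` (`d < d + 1`): `P` of `Y`-degree `d ≥ 1` with `P(ℓ₂, ρ) = 0`, `∂P/∂x (ℓ₂, ρ) ≠ 0` and
`ρ ∈ Skel₍d+1₎` is contradictory.  (Gauss `2^{N!} ≤ C₃ q^d` against the core's `q^{(d+1)N} < C 2^{(N+1)!}`:
`2^{N!(d+1)N} < 2^{L((d+1)N + d) + (N+1)!·d}`, against `onCurve_exponent_ineq` — the `x`-degree `k` never enters.) -/
theorem engine {P : ℤ[X][X]} {ρ : ℝ} (hd : 1 ≤ P.natDegree)
    (hroot : bev P (liouvilleNumber 2) ρ = 0) (hτ : bev (dX P) (liouvilleNumber 2) ρ ≠ 0)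
    (hρ : SkelLiouvilleFix (P.natDegree + 1) ρ) : False :=
  engine_of_clause (m := P.natDegree + 1) (by omega) hd hroot hτ hρ
    fun C => lowDegree_clause (Nat.lt_succ_self _) C

end Engine

/-! ## §5  THE DEGREE LADDER and its corollaries -/

section Ladder

/-- DESCENT (minimal `x`-degree).  If `ρ` is transcendental and an «engine» refutes every relation `Q(ℓ₂, ρ) = 0`
of `Y`-degree in `[1, d]` with `∂Q/∂x (ℓ₂, ρ) ≠ 0`, then there is NO relation of `Y`-degree `≤ d` at all:
a relation of minimal `x`-degree has `∂Q/∂x (ℓ₂, ρ) ≠ 0` (else `∂Q/∂x` is a smaller relation), `x`-degree `≥ 1`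
(else `ρ` is algebraic) and `Y`-degree `≥ 1` (else `ℓ₂` is algebraic). -/
theorem no_relation_of_engine {ρ : ℝ} {d : ℕ} (hρT : Transcendental ℤ ρ)
    (hE : ∀ Q : ℤ[X][X], Q ≠ 0 → 1 ≤ Q.natDegree → Q.natDegree ≤ d →
      bev Q (liouvilleNumber 2) ρ = 0 → bev (dX Q) (liouvilleNumber 2) ρ ≠ 0 → False)
    (P : ℤ[X][X]) (hP : P ≠ 0) (hdeg : P.natDegree ≤ d) : bev P (liouvilleNumber 2) ρ ≠ 0 := by
  classical
  intro hroot
  have hex : ∃ n, ∃ Q : ℤ[X][X], Q ≠ 0 ∧ Q.natDegree ≤ d ∧ bev Q (liouvilleNumber 2) ρ = 0 ∧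
      xdeg Q = n := ⟨_, P, hP, hdeg, hroot, rfl⟩
  obtain ⟨Q, hQ0, hQdeg, hQroot, hQx⟩ := Nat.find_spec hex
  have hmin : ∀ Q' : ℤ[X][X], Q' ≠ 0 → Q'.natDegree ≤ d → bev Q' (liouvilleNumber 2) ρ = 0 →
      xdeg Q ≤ xdeg Q' := by
    intro Q' h1 h2 h3
    rw [hQx]
    exact Nat.find_min' hex ⟨Q', h1, h2, h3, rfl⟩
  by_cases hx : xdeg Q = 0
  · -- every `Y`-coefficient is a constant: `ρ` is a root of a non-zero integer polynomial
    have hrel := bev_eq_aeval_of_xdeg_eq_zero hx (liouvilleNumber 2) ρ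
    rw [hQroot] at hrel
    set R : ℤ[X] := ∑ j ∈ Finset.range (Q.natDegree + 1), C ((Q.coeff j).coeff 0) * X ^ j with hR
    have hR0 : R ≠ 0 := by
      intro h0
      have hlc : Q.leadingCoeff ≠ 0 := leadingCoeff_ne_zero.mpr hQ0
      have hc : R.coeff Q.natDegree = (Q.coeff Q.natDegree).coeff 0 := by
        rw [hR, finsetSum_coeff]
        simp only [coeff_C_mul, coeff_X_pow, mul_ite, mul_one, mul_zero]
        rw [Finset.sum_ite_eq, if_pos (Finset.mem_range.mpr (Nat.lt_succ_self _))]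
      have hdeg0 : (Q.coeff Q.natDegree).natDegree = 0 := by
        have := natDegree_coeff_le_xdeg Q Q.natDegree; omega
      have hQC : Q.coeff Q.natDegree = C ((Q.coeff Q.natDegree).coeff 0) :=
        eq_C_of_natDegree_eq_zero hdeg0
      apply hlc
      rw [leadingCoeff, hQC, ← hc, h0, coeff_zero, C_0]
    exact hρT ⟨R, hR0, hrel.symm⟩
  · have hx1 : 1 ≤ xdeg Q := by omega
    -- `(∂Q/∂x)(ℓ₂, ρ) ≠ 0` by minimality of the `x`-degree (else `dX Q` is a smaller relation)
    have hτ : bev (dX Q) (liouvilleNumber 2) ρ ≠ 0 := by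
      intro h0
      have h1 := hmin (dX Q) (dX_ne_zero hx1) ((natDegree_dX_le Q).trans hQdeg) h0
      have h2 := xdeg_dX_lt hx1
      omega
    by_cases hQd : Q.natDegree = 0
    · -- `Q = C Q₀`: the relation is `Q₀(ℓ₂) = 0`, impossible (`ℓ₂` is transcendental)
      have hQC : Q = C (Q.coeff 0) := eq_C_of_natDegree_eq_zero hQd
      have h1 : bev Q (liouvilleNumber 2) ρ = aeval (liouvilleNumber 2) (Q.coeff 0) := by
        rw [hQC, bev_C, coeff_C_zero]
      have hQ00 : Q.coeff 0 ≠ 0 := by intro h; apply hQ0; rw [hQC, h, C_0]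
      exact liouville_ell2.transcendental ⟨Q.coeff 0, hQ00, by rw [← h1, hQroot]⟩
    · exact hE Q hQ0 (by omega) hQdeg hQroot hτ

/-- **DEGREE LADDER AT FIXED SKEL-QUALITY (DL).**  For every `d` and every `ρ ∈ Skel₍d+1₎`
(`|ρ − a/q| < q^{−(d+1)·ι(q)}` along denominators `q → ∞`), NO non-zero `P ∈ ℤ[X][Y]` of `Y`-degree `≤ d`
— of ANY `x`-degree and ANY height — has `P(ℓ₂, ρ) = 0` (`X ↦ ℓ₂ = liouvilleNumber 2`, `Y ↦ ρ`). -/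
theorem degreeLadder (d : ℕ) (ρ : ℝ) (hρ : SkelLiouvilleFix (d + 1) ρ) (P : ℤ[X][X]) (hP : P ≠ 0)
    (hdeg : P.natDegree ≤ d) : bev P (liouvilleNumber 2) ρ ≠ 0 :=
  no_relation_of_engine (hρ.transcendental (by omega))
    (fun Q _ hd1 hQd hroot hτ => engine hd1 hroot hτ (hρ.mono (by omega))) P hP hdeg

/-- DL on the whole intersection `Skel = ⋂ₘ Skel₍ₘ₎`: NO integer relation `P(ℓ₂, ρ) = 0` at all. -/
theorem no_relation_of_forall_fix {ρ : ℝ} (hρ : ∀ m, SkelLiouvilleFix m ρ) (P : ℤ[X][X])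
    (hP : P ≠ 0) : bev P (liouvilleNumber 2) ρ ≠ 0 :=
  degreeLadder P.natDegree ρ (hρ _) P hP le_rfl

/-- The `d → ∞` reading: a Skel-Liouville `ρ` (all multiples) satisfies no integer relation `P(ℓ₂, ρ) = 0` at all. -/
theorem no_relation_of_skelLiouville {ρ : ℝ} (hρ : SkelLiouville ρ) (P : ℤ[X][X]) (hP : P ≠ 0) :
    bev P (liouvilleNumber 2) ρ ≠ 0 :=
  no_relation_of_forall_fix (skelLiouvilleFix_of_skelLiouville hρ) P hP

end Ladder

end Summit.Schanuel.Schanuel.Theorems.RootDecomp1KDegreeLadder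

end
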